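import Summits.PneNP.PneNP.Theorems.ChebyshevTracialDesignLevelCountObstruction
import Literature.Combinatorics.Optimization.ChebyshevExtrapolationDesign
import HarnessLib

/-!
# Cell pnp-psdrank, route `ChebyshevTracialDesign`: the level-count obstruction on the route's own design — the
# Chebyshev design weight is fooled in dimension `n^{O(dq n)}`, and the polynomial-scale decay has a bounded exponent

End-to-end instance of N3 (`ChebyshevTracialDesignLevelCountObstruction.levelWeight_fooled`) on the explicit balanced exact
extrapolation design of the tree (`Literature.Combinatorics.Optimization.ChebyshevDesign`: cut size `tOf n`, nodes
`3 + 4·sOf n·j²`, `j ≤ dq n`, Lagrange weights; `chebyshevDesignExistsBal_twenty`):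
* `chebyshevDesign_isBalancedDesign` — the explicit witness is a balanced exact design with `dq n + 1` levels
  (`card_nodes`), all in `[3, n]`;
* `chebyshevDesign_fooled` — for every even `n ≥ 100`, with `D = dq n`, the design weight
  `W_n = levelWeight n (tOf n) (nodes D (sOf n)) (weight D (sOf n))` (`⟨W_n, S⟩ = 1`) has, for every
  `γ < 1/((D+2)^5 (n+1)^{8D+11})`, a dimension `r ≤ (D+2)(n+1)^{2D+2}` at which `TracialValueLEAt W_n γ r` FAILS;
* `not_tracialDecayDimBal_of_le` — consequently the POLYNOMIAL-scale decay statement `TracialDecayDimBal a 20`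
  (route aside `TracialDecay20 := ∃ a > 0, TracialDecayDimBal a 20`, stmt-PneNP-19646: value `≤ n^{−a·dq n}` in the budget
  `r²·n < n^{a·dq n}`) is FALSE for every `a ≥ 44`: the fooling dimension `n^{Θ(dq n)}` enters the budget. So that item can
  only hold with a bounded exponent, i.e. the method certifies psd rank at most `2^{O(n^{1/4} log n)}` — the route's own
  target scale (`MatchingPsdRankStretchedExp`, `δ = 1/4`) is also its ceiling. (The EXP-normalised crux
  `TracialDecayExp20`, budget `exp(a·dq n)`, is not touched: `n^{Θ(dq n)}` never enters that budget.)
WHAT THIS IS NOT: not a refutation of `TracialDecay20` (which asks for SOME `a > 0`), not a statement about psd rank.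
Supports aside stmt-PneNP-19646 by capping its parameter; instrument.
-/

set_option linter.dupNamespace false -- `Summit.PneNP.PneNP.…`: summit = sub-problem (D-0017)

noncomputable section

open scoped Classical

namespace Summit.PneNP.PneNP.Theorems.ChebyshevTracialDesignDecayCap

open Finset Matrix Literature.Barriers.PneNP Literature.Combinatorics.Optimization
  Literature.Combinatorics.Optimization.ChebyshevDesign Summit.PneNP.PneNP.Theorems.ChebyshevTracialDesignLevelCount

/-! ### §1 The explicit Chebyshev design of the tree -/

/-- The explicit design has `dq n + 1` nodes (for `n ≥ 100`). -/
theorem card_nodes {n : ℕ} (hn : 100 ≤ n) : (ChebyshevDesign.nodes (dq n) (sOf n)).card = dq n + 1 := by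
  unfold ChebyshevDesign.nodes
  rw [card_image_of_injective _ (nodeN_injective (sOf_pos hn)), card_range]

/-- The explicit witness of `chebyshevDesignExistsBal_twenty` is a balanced exact design (same proof as there). -/
theorem chebyshevDesign_isBalancedDesign {n : ℕ} (hn : 100 ≤ n) (he : Even n) :
    IsBalancedDesign n (tOf n) (Tq n) (dq n) 20 (ChebyshevDesign.nodes (dq n) (sOf n)) (weight (dq n) (sOf n)) := by
  refine ⟨?_, (tOf_spec hn he).2.2.1⟩
  obtain ⟨hodd, h2t, -, -⟩ := tOf_spec hn he
  have hS := sOf_pos hn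
  refine ⟨hodd, h2t, Tq_le_tOf hn he, ?_, normalised hS (dq_pos hn), fun p hp => exact hS p hp, variation hS⟩
  intro c hc
  obtain ⟨j, hj, rfl⟩ := mem_image.1 hc
  have hjD : j ≤ dq n := Nat.lt_succ_iff.1 (mem_range.1 hj)
  have hle : nodeN (sOf n) j ≤ Tq n := nodeN_le_Tq j hjD
  refine ⟨odd_nodeN _ _, by rw [nodeN]; omega, hle, ?_⟩
  exact qset_nonempty_of_two_mul_add_two_le he hodd h2t (odd_nodeN _ _) (hle.trans (Tq_le_tOf hn he))

/-- The nodes lie in `[3, n]`; in particular `1` is not a node. -/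
theorem three_le_of_mem_nodes {n c : ℕ} (hn : 100 ≤ n) (he : Even n) (hc : c ∈ ChebyshevDesign.nodes (dq n) (sOf n)) :
    3 ≤ c ∧ c ≤ n := by
  have hdes := (chebyshevDesign_isBalancedDesign hn he).1
  obtain ⟨-, h3, hT, -⟩ := hdes.2.2.2.1 c hc
  exact ⟨h3, hT.trans (hdes.2.2.1.trans (by have := hdes.2.1; omega))⟩

/-! ### §2 The design weight is fooled in dimension `n^{O(dq n)}` -/

/-- **The route's Chebyshev design weight is fooled in dimension `n^{O(dq n)}`**: for even `n ≥ 100`, `D = dq n`, and every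
`γ < 1/((D+2)^5 (n+1)^{8D+11})` there is `r ≤ (D+2)(n+1)^{2D+2}` with `¬ TracialValueLEAt W_n γ r`. -/
theorem chebyshevDesign_fooled {n : ℕ} (hn : 100 ≤ n) (he : Even n) {γ : ℝ}
    (hγ : γ < 1 / ((((dq n + 1 : ℕ) : ℝ) + 1) ^ 5 * ((n : ℝ) + 1) ^ (8 * (dq n + 1) + 3))) :
    ∃ r : ℕ, 0 < r ∧ (r : ℝ) ≤ (((dq n + 1 : ℕ) : ℝ) + 1) * ((n : ℝ) + 1) ^ (2 * (dq n + 1)) ∧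
      ¬ TracialValueLEAt (levelWeight n (tOf n) (ChebyshevDesign.nodes (dq n) (sOf n)) (weight (dq n) (sOf n))) γ r := by
  have hdes := (chebyshevDesign_isBalancedDesign hn he).1
  have hcard := card_nodes hn
  have h1 : 1 ∉ ChebyshevDesign.nodes (dq n) (sOf n) := fun h => by have := (three_le_of_mem_nodes hn he h).1; omega
  have hLn : ∀ c ∈ ChebyshevDesign.nodes (dq n) (sOf n), c ≤ n := fun c hc => (three_le_of_mem_nodes hn he hc).2
  have hne : ∀ c ∈ ChebyshevDesign.nodes (dq n) (sOf n), (Qset n (tOf n) c).Nonempty := fun c hc => (hdes.2.2.2.1 c hc).2.2.2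
  have hsum : ∑ c ∈ ChebyshevDesign.nodes (dq n) (sOf n), weight (dq n) (sOf n) c * ((c : ℝ) - 1) = 1 := hdes.2.2.2.2.1
  have hres := levelWeight_fooled (n := n) (t := tOf n) (ChebyshevDesign.nodes (dq n) (sOf n)) (weight (dq n) (sOf n)) h1 hLn hne
    (by rw [hsum]; exact zero_le_one) (γ := γ) (by rw [hsum, hcard]; exact hγ)
  rw [hcard] at hres
  exact hres

/-! ### §3 The polynomial-scale decay has a bounded exponent -/

/-- Arithmetic: `(D+2)²(n+1)^{4D+4}·n < n^{a D}` and `n^{−aD} < 1/((D+2)^5 (n+1)^{8D+11})` for `a ≥ 44`, `1 ≤ D ≤ n − 2`,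
`n ≥ 2` — both because `(n+1)^k ≤ n^{2k}` and `D + 2 ≤ n`. Stated with real powers. -/
theorem cap_arith {n D : ℕ} {a : ℝ} (hn : 2 ≤ n) (hD : 1 ≤ D) (hDn : D + 2 ≤ n) (ha : 44 ≤ a) :
    ((((D + 1 : ℕ) : ℝ) + 1) * ((n : ℝ) + 1) ^ (2 * (D + 1))) ^ 2 * n < (n : ℝ) ^ (a * D) ∧
      (n : ℝ) ^ (-(a * D)) < 1 / ((((D + 1 : ℕ) : ℝ) + 1) ^ 5 * ((n : ℝ) + 1) ^ (8 * (D + 1) + 3)) := by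
  have hn1 : (1 : ℝ) < n := by exact_mod_cast hn
  have hn0 : (0 : ℝ) < n := by linarith
  have hD2 : ((D + 1 : ℕ) : ℝ) + 1 ≤ n := by exact_mod_cast (show D + 1 + 1 ≤ n by omega)
  have hD0 : (0 : ℝ) ≤ ((D + 1 : ℕ) : ℝ) + 1 := by positivity
  -- `(n+1)^k ≤ n^(2k)`
  have hn2 : (2 : ℝ) ≤ n := by exact_mod_cast hn
  have hsq : (n : ℝ) + 1 ≤ (n : ℝ) ^ 2 := by nlinarith
  have hpow : ∀ k : ℕ, ((n : ℝ) + 1) ^ k ≤ (n : ℝ) ^ (2 * k) := fun k => by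
    rw [pow_mul]; exact pow_le_pow_left₀ (by positivity) hsq k
  -- natural-exponent comparisons
  have hmono : ∀ {i j : ℕ}, i ≤ j → (n : ℝ) ^ i ≤ (n : ℝ) ^ j := fun hij => pow_le_pow_right₀ hn1.le hij
  -- real-exponent comparison `n^(k) ≤ n^(a D)` for `k ≤ 44 D`
  have hreal : ∀ k : ℕ, k ≤ 44 * D → (n : ℝ) ^ k ≤ (n : ℝ) ^ (a * D) := by
    intro k hk
    rw [← Real.rpow_natCast]
    apply Real.rpow_le_rpow_of_exponent_le hn1.le
    have h1 : (k : ℝ) ≤ 44 * D := by exact_mod_cast hk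
    have h2 : (44 : ℝ) * D ≤ a * D := mul_le_mul_of_nonneg_right ha (Nat.cast_nonneg D)
    linarith
  constructor
  · -- budget
    have hb : (((D + 1 : ℕ) : ℝ) + 1) * ((n : ℝ) + 1) ^ (2 * (D + 1)) ≤ (n : ℝ) * (n : ℝ) ^ (2 * (2 * (D + 1))) :=
      mul_le_mul hD2 (hpow _) (by positivity) hn0.le
    calc ((((D + 1 : ℕ) : ℝ) + 1) * ((n : ℝ) + 1) ^ (2 * (D + 1))) ^ 2 * n
        ≤ ((n : ℝ) * (n : ℝ) ^ (2 * (2 * (D + 1)))) ^ 2 * n :=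
          mul_le_mul_of_nonneg_right (pow_le_pow_left₀ (by positivity) hb 2) hn0.le
      _ = (n : ℝ) ^ (8 * D + 11) := by ring
      _ < (n : ℝ) ^ (8 * D + 12) := pow_lt_pow_right₀ hn1 (by omega)
      _ ≤ (n : ℝ) ^ (a * D) := hreal _ (by omega)
  · -- threshold
    have hden : 0 < (((D + 1 : ℕ) : ℝ) + 1) ^ 5 * ((n : ℝ) + 1) ^ (8 * (D + 1) + 3) := by positivity
    rw [Real.rpow_neg hn0.le, ← one_div, one_div_lt_one_div (Real.rpow_pos_of_pos hn0 _) hden]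
    calc (((D + 1 : ℕ) : ℝ) + 1) ^ 5 * ((n : ℝ) + 1) ^ (8 * (D + 1) + 3)
        ≤ (n : ℝ) ^ 5 * (n : ℝ) ^ (2 * (8 * (D + 1) + 3)) :=
          mul_le_mul (pow_le_pow_left₀ hD0 hD2 5) (hpow _) (by positivity) (by positivity)
      _ = (n : ℝ) ^ (16 * D + 27) := by ring
      _ < (n : ℝ) ^ (16 * D + 28) := pow_lt_pow_right₀ hn1 (by omega)
      _ ≤ (n : ℝ) ^ (a * D) := hreal _ (by omega)

/-- `dq n + 2 ≤ n` for `n ≥ 100`. -/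
theorem dq_add_two_le {n : ℕ} (hn : 100 ≤ n) : dq n + 2 ≤ n := by
  have h1 : dq n ≤ Nat.sqrt n := by rw [dq]; exact Nat.sqrt_le_self _
  have h2 : Nat.sqrt n * Nat.sqrt n ≤ n := Nat.sqrt_le n
  have h3 : 10 ≤ Nat.sqrt n := sqrt_ge hn
  nlinarith

/-- **The polynomial-scale tracial decay has a bounded exponent**: `TracialDecayDimBal a 20` is false for every `a ≥ 44`
(the route's aside `TracialDecay20 := ∃ a > 0, TracialDecayDimBal a 20` can only be witnessed by `a < 44`; the method's ceiling
is psd rank `2^{O(n^{1/4} log n)}`). -/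
theorem not_tracialDecayDimBal_of_le {a : ℝ} (ha : 44 ≤ a) : ¬ TracialDecayDimBal a 20 := by
  rintro ⟨n₁, H⟩
  -- an even `n ≥ max n₁ 100`
  set n : ℕ := 2 * (n₁ + 100) with hn
  have hn₁ : n₁ ≤ n := by omega
  have hn100 : 100 ≤ n := by omega
  have he : Even n := ⟨n₁ + 100, by omega⟩
  have hD := dq_pos hn100
  obtain ⟨hbud, hthr⟩ := cap_arith (a := a) (by omega) hD (dq_add_two_le hn100) ha
  obtain ⟨r, hr0, hrle, hnot⟩ := chebyshevDesign_fooled hn100 he hthr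
  refine hnot (H n hn₁ he (tOf n) _ _ (chebyshevDesign_isBalancedDesign hn100 he) r hr0 ?_)
  -- the fooling dimension is inside the budget
  have hr' : (0 : ℝ) ≤ r := Nat.cast_nonneg r
  calc (r : ℝ) ^ 2 * n ≤ ((((dq n + 1 : ℕ) : ℝ) + 1) * ((n : ℝ) + 1) ^ (2 * (dq n + 1))) ^ 2 * n := by
        gcongr
    _ < (n : ℝ) ^ (a * (dq n : ℝ)) := hbud

end Summit.PneNP.PneNP.Theorems.ChebyshevTracialDesignDecayCap

end
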